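import Mathlib
import Summits.NavierStokesRegularity.NavierStokesRegularity.Theorems.StretchingWellBindingEnstrophyQuarterLawSwarmTimes
import HarnessLib

/-!
# Shelf crux `EnstrophyQuarterLaw` (stmt-NavierStokesRegularity-1574), line «sparse_sieve»:
# stub S1's ENERGY HALF below the enstrophy scale, and its exceptional times (unconditional)

Helper file (`--supports stmt-NavierStokesRegularity-1574 --as helper`) for the OPEN registered stub
`stub_uniformLocalTypeI` (S1: `UniformLocalTypeI T u` = the CKN quantities `A` (local energy `R⁻¹∫_{B_R}|u(s)|² ≤ M`)
and `E` (local dissipation) bounded at scales `≤ r₀`, uniformly up to `T`). S1 follows from stub 6 (0056,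
`Registered.stub_uniformLocalTypeI_of_stub_noTypeII`); unconditionally this file records for the `A`-half the same
two elementary facts the `EnstrophyScale*`/`SwarmTimes` files record for S2 (`Z(s) = ∫ |curl u(s)|²`):

* `setLIntegral_ball_norm_sq_le` (static): `∫_{B(x,R)} |v|² ≤ |B(x,R)|^{2/3} · K² · ∫|curl v|²` for divergence-free
  `C²` fields with `v, Dv, D²v ∈ L²` (Hölder `L²(B) ⊂ L⁶(B)` + `∫|v|⁶ ≤ K⁶ Z³`);
* `localEnergy_le_enstrophy` — absolute `C_A`: along every first blow-up, `∫_{B(x,R)} |u(s)|² ≤ C_A R² Z(s)` for all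
  `s ∈ [0,T)`, `x`, `R > 0`; hence (`localEnergy_le_of_below_enstrophy_scale`) the S1-`A` inequality
  `∫_{B(x,R)}|u(s)|² ≤ M R` holds whenever `R · Z(s) ≤ M / C_A` — BELOW THE ENSTROPHY SCALE, for every `M`;
* `volume_localEnergy_exceptionalTimes_le` — the times `s ∈ (0,T)` at which `∫_{B(x,R)}|u(s)|² > M R` for SOME
  centre `x` have measure `≤ C_A R E₀/(ν M)` (Markov on `∫₀ᵀ Z ≤ E₀/ν`, `setLIntegral_enstrophy_le_lifespan`).

READING (census currency): like S2, the `A`-half of S1 is open only above the enstrophy scale (`R Z(s) ≫ M`) and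
fails at most on a time set of measure `O(R/M)`; the `E`-half (a parabolic-window quantity) is not treated here.
HONEST FRAMING: elementary unconditional bookkeeping along a HYPOTHETICAL blow-up; S1, S2, 0056, the crux
`EnstrophyQuarterLaw` (1574) and Navier–Stokes regularity stay OPEN; no summit statement is proved.
-/

noncomputable section

-- the summit and its single sub-problem share the name (CONVENTIONS §1), as in every Theorems file
set_option linter.dupNamespace false

namespace Summit.NavierStokesRegularity.NavierStokesRegularity.Theorems.EnstrophyQuarterLaw.EnstrophyScale

open MeasureTheory Set Metric Module
open Literature.Analysis Literature.Analysis.FluidPDE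
open scoped ENNReal NNReal

/-! ### Static: local energy of a ball against the enstrophy -/

/-- **`∫_{B} |v|² ≤ |B|^{2/3} K² ∫|curl v|²`** on every ball, for a divergence-free `C²` field `v : ℝ³ → ℝ³` with
`v, Dv, D²v ∈ L²` (Hölder with exponents `3, 3/2` against `1`, then `∫ |v|⁶ ≤ K⁶ (∫|curl v|²)³`,
`lintegral_enorm_pow_six_le`). [folklore] -/
theorem setLIntegral_ball_norm_sq_le {v : EuclideanSpace ℝ (Fin 3) → EuclideanSpace ℝ (Fin 3)}
    (hv : ContDiff ℝ 2 v) (hdiv : VectorCalculus.IsDivFree v) (h0 : ∫⁻ x, ‖v x‖ₑ ^ 2 < ⊤)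
    (h1 : ∫⁻ x, ‖iteratedFDeriv ℝ 1 v x‖ₑ ^ 2 < ⊤) (h2 : ∫⁻ x, ‖iteratedFDeriv ℝ 2 v x‖ₑ ^ 2 < ⊤)
    (x : EuclideanSpace ℝ (Fin 3)) (R : ℝ) :
    ∫⁻ y in ball x R, ‖v y‖ₑ ^ 2 ≤
      volume (ball x R) ^ (2 / 3 : ℝ) *
        ((SNormLESNormFDerivOfEqConst (EuclideanSpace ℝ (Fin 3)) (volume : Measure (EuclideanSpace ℝ (Fin 3))) 2 : ℝ≥0∞) ^ 2 *
          ∫⁻ y, ‖curl v y‖ₑ ^ 2) := by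
  set Kₑ : ℝ≥0∞ := (SNormLESNormFDerivOfEqConst (EuclideanSpace ℝ (Fin 3))
    (volume : Measure (EuclideanSpace ℝ (Fin 3))) 2 : ℝ≥0∞) with hKₑ
  set Z : ℝ≥0∞ := ∫⁻ y, ‖curl v y‖ₑ ^ 2 with hZ
  have hvm : AEMeasurable (fun y => ‖v y‖ₑ ^ 2) (volume.restrict (ball x R)) :=
    (hv.continuous.measurable.enorm.pow_const 2).aemeasurable
  have hpq : Real.HolderConjugate 3 (3 / 2 : ℝ) := by
    rw [Real.holderConjugate_iff]; norm_num
  have hH := ENNReal.lintegral_mul_le_Lp_mul_Lq (volume.restrict (ball x R)) hpq hvm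
    (g := fun _ => (1 : ℝ≥0∞)) aemeasurable_const
  have hfg : (fun y => ‖v y‖ₑ ^ 2) * (fun _ => (1 : ℝ≥0∞)) = fun y => ‖v y‖ₑ ^ 2 := by
    funext y; simp
  rw [hfg] at hH
  have hone : (∫⁻ _ in ball x R, (1 : ℝ≥0∞) ^ (3 / 2 : ℝ)) ^ (1 / (3 / 2 : ℝ)) =
      volume (ball x R) ^ (2 / 3 : ℝ) := by
    simp only [ENNReal.one_rpow, lintegral_const, Measure.restrict_apply MeasurableSet.univ, univ_inter, one_mul]
    norm_num
  have hsix : ∫⁻ y in ball x R, (‖v y‖ₑ ^ 2) ^ (3 : ℝ) ≤ ∫⁻ y, ‖v y‖ₑ ^ 6 := by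
    calc ∫⁻ y in ball x R, (‖v y‖ₑ ^ 2) ^ (3 : ℝ)
        = ∫⁻ y in ball x R, ‖v y‖ₑ ^ 6 := by
          refine lintegral_congr fun y => ?_
          rw [show (3 : ℝ) = ((3 : ℕ) : ℝ) by norm_num, ENNReal.rpow_natCast, ← pow_mul]
      _ ≤ ∫⁻ y, ‖v y‖ₑ ^ 6 := setLIntegral_le_lintegral _ _
  have h6 := lintegral_enorm_pow_six_le hv hdiv h0 h1 h2
  -- `(K⁶ Z³)^{1/3} = K² Z`
  have hroot : (Kₑ ^ 6 * Z ^ 3) ^ (1 / (3 : ℝ)) = Kₑ ^ 2 * Z := by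
    rw [show Kₑ ^ 6 * Z ^ 3 = (Kₑ ^ 2 * Z) ^ 3 by ring, ← ENNReal.rpow_natCast, ← ENNReal.rpow_mul]
    norm_num
  calc ∫⁻ y in ball x R, ‖v y‖ₑ ^ 2
      ≤ (∫⁻ y in ball x R, (‖v y‖ₑ ^ 2) ^ (3 : ℝ)) ^ (1 / (3 : ℝ)) *
          (∫⁻ _ in ball x R, (1 : ℝ≥0∞) ^ (3 / 2 : ℝ)) ^ (1 / (3 / 2 : ℝ)) := hH
    _ ≤ (Kₑ ^ 6 * Z ^ 3) ^ (1 / (3 : ℝ)) * volume (ball x R) ^ (2 / 3 : ℝ) := by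
        rw [hone]
        gcongr
        exact hsix.trans h6
    _ = volume (ball x R) ^ (2 / 3 : ℝ) * (Kₑ ^ 2 * Z) := by rw [hroot, mul_comm]

/-! ### Along a first blow-up -/

/-- **Local energy against the enstrophy (every first blow-up, every time).** There is an absolute `C_A > 0` such
that for every maximal classical solution `u` on `[0,T)` that is Leray–Hopf from its rapidly decaying datum, every
`s ∈ [0,T)`, centre `x` and radius `R > 0`: `∫_{B(x,R)} |u(s)|² ≤ C_A R² Z(s)` (`C_A = |B₁|^{2/3} K²`). [folklore] -/
theorem localEnergy_le_enstrophy :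
    ∃ C_A : ℝ, 0 < C_A ∧ ∀ (ν T : ℝ), 0 < ν → 0 < T →
      ∀ (u : ℝ → EuclideanSpace ℝ (Fin 3) → EuclideanSpace ℝ (Fin 3))
        (p : ℝ → EuclideanSpace ℝ (Fin 3) → ℝ),
      IsMaximalSmoothSolution ν 0 u p T → IsLerayHopfOn T ν 0 (u 0) u →
      HasRapidSpatialDecay (u 0) →
      ∀ s ∈ Set.Ico 0 T, ∀ (x : EuclideanSpace ℝ (Fin 3)) (R : ℝ), 0 < R →
        ∫⁻ y in Metric.ball x R, ‖u s y‖ₑ ^ 2 ≤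
          ENNReal.ofReal (C_A * R ^ 2 * (∫⁻ y, ‖curl (u s) y‖ₑ ^ 2).toReal) := by
  set Kₑ : ℝ≥0∞ := (SNormLESNormFDerivOfEqConst (EuclideanSpace ℝ (Fin 3))
    (volume : Measure (EuclideanSpace ℝ (Fin 3))) 2 : ℝ≥0∞) with hKₑ
  set V₁ : ℝ≥0∞ := volume (ball (0 : EuclideanSpace ℝ (Fin 3)) 1) with hV₁
  have hV₁top : V₁ ≠ ⊤ := measure_ball_lt_top.ne
  set M : ℝ≥0∞ := V₁ ^ (2 / 3 : ℝ) * Kₑ ^ 2 with hM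
  have hMtop : M ≠ ⊤ :=
    ENNReal.mul_ne_top (ENNReal.rpow_ne_top_of_nonneg (by norm_num) hV₁top) (ENNReal.pow_ne_top ENNReal.coe_ne_top)
  set Mr : ℝ := M.toReal with hMr
  have hMr0 : 0 ≤ Mr := ENNReal.toReal_nonneg
  refine ⟨Mr + 1, by positivity, ?_⟩
  intro ν T hν hT u p hmax hLH hdec s hs x R hR
  have hcl : IsClassicalNSSolutionOn (Ico 0 T) ν 0 u p := hmax.1
  have hn := lintegral_iteratedFDeriv_sq_lt_top hν hcl hLH hdec hs
  have hv : ContDiff ℝ 2 (u s) := (hcl.contDiff_velocity hs).of_le (by norm_cast)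
  have h0 : ∫⁻ y, ‖u s y‖ₑ ^ 2 < ⊤ := by
    refine lt_of_le_of_lt (le_of_eq (lintegral_congr fun y => ?_)) (hn 0)
    rw [← ofReal_norm, ← norm_iteratedFDeriv_zero (𝕜 := ℝ) (f := u s), ofReal_norm]
  set Z : ℝ≥0∞ := ∫⁻ y, ‖curl (u s) y‖ₑ ^ 2 with hZ
  have hZtop : Z ≠ ⊤ :=
    (lt_of_le_of_lt (lintegral_curl_sq_le (u s)) (ENNReal.mul_lt_top ENNReal.ofReal_lt_top (hn 1))).ne
  have hstat := setLIntegral_ball_norm_sq_le hv (hcl.divFree s hs) h0 (hn 1) (hn 2) x R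
  have hvol : volume (ball x R) = ENNReal.ofReal R ^ 3 * V₁ := by
    rw [Measure.addHaar_ball_of_pos _ _ hR, finrank_euclideanSpace_fin, ENNReal.ofReal_pow hR.le]
  have hvol23 : volume (ball x R) ^ (2 / 3 : ℝ) = ENNReal.ofReal R ^ 2 * V₁ ^ (2 / 3 : ℝ) := by
    rw [hvol, ENNReal.mul_rpow_of_nonneg _ _ (by norm_num), ← ENNReal.rpow_natCast,
      ← ENNReal.rpow_mul, ← ENNReal.rpow_natCast (ENNReal.ofReal R) 2]
    norm_num
  calc ∫⁻ y in ball x R, ‖u s y‖ₑ ^ 2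
      ≤ volume (ball x R) ^ (2 / 3 : ℝ) * (Kₑ ^ 2 * Z) := hstat
    _ = M * (ENNReal.ofReal R ^ 2 * Z) := by rw [hvol23, hM]; ring
    _ = ENNReal.ofReal (Mr * (R ^ 2 * Z.toReal)) := by
        rw [ENNReal.ofReal_mul hMr0, hMr, ENNReal.ofReal_toReal hMtop, ENNReal.ofReal_mul (by positivity),
          ENNReal.ofReal_pow hR.le, ENNReal.ofReal_toReal hZtop]
    _ ≤ ENNReal.ofReal ((Mr + 1) * R ^ 2 * Z.toReal) := by
        refine ENNReal.ofReal_le_ofReal ?_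
        have : 0 ≤ R ^ 2 * Z.toReal := by positivity
        nlinarith

/-- **The S1-`A` inequality below the enstrophy scale.** With the absolute `C_A` of `localEnergy_le_enstrophy`:
for every first blow-up, every `M > 0`, `s ∈ [0,T)`, `x`, and `R > 0` with `R · Z(s) ≤ M / C_A`, the registered
S1 energy bound `∫_{B(x,R)} |u(s)|² ≤ M R` holds. [folklore] -/
theorem localEnergy_le_of_below_enstrophy_scale :
    ∃ C_A : ℝ, 0 < C_A ∧ ∀ (ν T : ℝ), 0 < ν → 0 < T →
      ∀ (u : ℝ → EuclideanSpace ℝ (Fin 3) → EuclideanSpace ℝ (Fin 3))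
        (p : ℝ → EuclideanSpace ℝ (Fin 3) → ℝ),
      IsMaximalSmoothSolution ν 0 u p T → IsLerayHopfOn T ν 0 (u 0) u →
      HasRapidSpatialDecay (u 0) →
      ∀ M : ℝ, 0 < M → ∀ s ∈ Set.Ico 0 T, ∀ (x : EuclideanSpace ℝ (Fin 3)) (R : ℝ), 0 < R →
        R * (∫⁻ y, ‖curl (u s) y‖ₑ ^ 2).toReal ≤ M / C_A →
        ∫⁻ y in Metric.ball x R, ‖u s y‖ₑ ^ 2 ≤ ENNReal.ofReal (M * R) := by
  obtain ⟨C_A, hC, h⟩ := localEnergy_le_enstrophy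
  refine ⟨C_A, hC, fun ν T hν hT u p hmax hLH hdec M hM s hs x R hR hRZ => ?_⟩
  refine (h ν T hν hT u p hmax hLH hdec s hs x R hR).trans (ENNReal.ofReal_le_ofReal ?_)
  have h1 : C_A * (R * (∫⁻ y, ‖curl (u s) y‖ₑ ^ 2).toReal) ≤ M := by
    rw [← le_div_iff₀' hC]; exact hRZ
  calc C_A * R ^ 2 * (∫⁻ y, ‖curl (u s) y‖ₑ ^ 2).toReal
      = R * (C_A * (R * (∫⁻ y, ‖curl (u s) y‖ₑ ^ 2).toReal)) := by ring
    _ ≤ R * M := mul_le_mul_of_nonneg_left h1 hR.le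
    _ = M * R := mul_comm _ _

/-- **The exceptional times of S1's energy half have measure `O(R/M)` (unconditional).** With the absolute `C_A`:
for every first blow-up, `M > 0` and `R > 0`, the set of times `s ∈ (0,T)` at which `∫_{B(x,R)} |u(s)|² > M R` for
SOME centre `x` has measure `≤ C_A R E₀/(ν M)` (`E₀ = ½∫|u₀|²`): at such a time `Z(s) > M/(C_A R)`, and
`∫_{(0,T)} Z ≤ E₀/ν` (`setLIntegral_enstrophy_le_lifespan`). [folklore] -/
theorem volume_localEnergy_exceptionalTimes_le :
    ∃ C_A : ℝ, 0 < C_A ∧ ∀ (ν T : ℝ), 0 < ν → 0 < T →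
      ∀ (u : ℝ → EuclideanSpace ℝ (Fin 3) → EuclideanSpace ℝ (Fin 3))
        (p : ℝ → EuclideanSpace ℝ (Fin 3) → ℝ),
      IsMaximalSmoothSolution ν 0 u p T → IsLerayHopfOn T ν 0 (u 0) u →
      HasRapidSpatialDecay (u 0) →
      ∀ M : ℝ, 0 < M → ∀ R : ℝ, 0 < R →
        volume {s ∈ Set.Ioo 0 T | ∃ x : EuclideanSpace ℝ (Fin 3),
          ENNReal.ofReal (M * R) < ∫⁻ y in Metric.ball x R, ‖u s y‖ₑ ^ 2} ≤
        ENNReal.ofReal (C_A * R * VectorCalculus.kineticEnergy (u 0) / (ν * M)) := by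
  obtain ⟨C_A, hC, hbelow⟩ := localEnergy_le_of_below_enstrophy_scale
  refine ⟨C_A, hC, fun ν T hν hT u p hmax hLH hdec M hM R hR => ?_⟩
  have hcl : IsClassicalNSSolutionOn (Ico 0 T) ν 0 u p := hmax.1
  set Z : ℝ → ℝ≥0∞ := fun t => ∫⁻ y, ‖curl (u t) y‖ₑ ^ 2 with hZ
  set lam : ℝ := M / (C_A * R) with hlam
  have hlampos : 0 < lam := by rw [hlam]; positivity
  set μ : Measure ℝ := volume.restrict (Ioo 0 T) with hμ
  -- (i) exceptional times lie in `{λ < Z}` ⊆ `{λ ≤ Z}`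
  have hsub : {s ∈ Set.Ioo 0 T | ∃ x : EuclideanSpace ℝ (Fin 3),
          ENNReal.ofReal (M * R) < ∫⁻ y in Metric.ball x R, ‖u s y‖ₑ ^ 2} ⊆
        {s | ENNReal.ofReal lam ≤ Z s} ∩ Ioo 0 T := by
    rintro s ⟨hs, x, hx⟩
    refine ⟨?_, hs⟩
    have hsI : s ∈ Ico 0 T := ⟨hs.1.le, hs.2⟩
    have hZtop : Z s ≠ ⊤ := by
      have hn := lintegral_iteratedFDeriv_sq_lt_top hν hcl hLH hdec hsI
      exact (lt_of_le_of_lt (lintegral_curl_sq_le (u s))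
        (ENNReal.mul_lt_top ENNReal.ofReal_lt_top (hn 1))).ne
    by_contra hlt
    simp only [Set.mem_setOf_eq, not_le] at hlt
    have hle : R * (Z s).toReal ≤ M / C_A := by
      have h1 : (Z s).toReal < lam := by
        have := hlt
        rw [← ENNReal.ofReal_toReal hZtop] at this
        exact (ENNReal.ofReal_lt_ofReal_iff_of_nonneg ENNReal.toReal_nonneg).1 this
      rw [hlam, lt_div_iff₀ (by positivity)] at h1
      rw [le_div_iff₀ hC]
      nlinarith
    exact absurd (hbelow ν T hν hT u p hmax hLH hdec M hM s hsI x R hR hle) (not_le.2 hx)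
  -- (ii) measurability of `Z` on `(0,T)`
  have hreg : ∀ T'' < T, HasBoundedSobolevNormsOn (Icc 0 T'') u := by
    intro T'' hT''
    by_cases hpos : 0 < T''
    · have hcl₁ : IsClassicalNSSolutionOn (Icc 0 T'') ν 0 u p :=
        hcl.mono (fun s hs => ⟨hs.1, lt_of_le_of_lt hs.2 hT''⟩) (uniqueDiffOn_Icc hpos)
      have hfe : ∃ C' : ℝ≥0, ∀ s ∈ Icc 0 T'', ∫⁻ x, ‖u s x‖ₑ ^ 2 ≤ C' := by
        refine ⟨(2 * VectorCalculus.kineticEnergy (u 0)).toNNReal, fun s hs => ?_⟩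
        have h := hLH.eEnergy_le_datum hν.le (t := s) ⟨hs.1, hs.2.trans hT''.le⟩
        exact h
      exact tao2011_hasBoundedSobolevNormsOn_holds hν hpos hcl₁ hfe hdec
    · intro n
      have hn0 := lintegral_iteratedFDeriv_sq_lt_top hν hcl hLH hdec (t := 0) ⟨le_rfl, hT⟩ n
      refine ⟨(∫⁻ x, ‖iteratedFDeriv ℝ n (u 0) x‖ₑ ^ 2).toNNReal, fun s hs => ?_⟩
      have hs0 : s = 0 := le_antisymm (hs.2.trans (not_lt.1 hpos)) hs.1
      rw [hs0, ENNReal.coe_toNNReal hn0.ne]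
  have hcont := hcl.continuousOn_integral_norm_curl_sq_Ico hreg
  have hZeq : ∀ t ∈ Ioo 0 T, Z t = ENNReal.ofReal (∫ x, ‖curl (u t) x‖ ^ 2) := by
    intro t ht
    have htI : t ∈ Ico 0 T := ⟨ht.1.le, ht.2⟩
    have hv : ContDiff ℝ 2 (u t) := (hcl.contDiff_velocity htI).of_le (by norm_cast)
    exact lintegral_enorm_curl_sq_eq_ofReal_integral hv (lintegral_iteratedFDeriv_sq_lt_top hν hcl hLH hdec htI 1)
  have hZmeas : AEMeasurable Z μ := by
    have hg : AEMeasurable (fun t => ENNReal.ofReal (∫ x, ‖curl (u t) x‖ ^ 2)) μ :=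
      ENNReal.measurable_ofReal.comp_aemeasurable
        ((hcont.mono fun t ht => ⟨ht.1.le, ht.2⟩).aemeasurable measurableSet_Ioo)
    refine hg.congr ?_
    rw [hμ, Filter.EventuallyEq, ae_restrict_iff' measurableSet_Ioo]
    exact Filter.Eventually.of_forall fun t ht => (hZeq t ht).symm
  -- (iii) Markov
  have hmarkov := mul_meas_ge_le_lintegral₀ hZmeas (ENNReal.ofReal lam)
  have hint : ∫⁻ t, Z t ∂μ ≤ ENNReal.ofReal (VectorCalculus.kineticEnergy (u 0) / ν) :=
    setLIntegral_enstrophy_le_lifespan hν hT hcl hLH hdec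
  have hmeas_le : μ {t | ENNReal.ofReal lam ≤ Z t} ≤
      ENNReal.ofReal (VectorCalculus.kineticEnergy (u 0) / ν) / ENNReal.ofReal lam := by
    rw [ENNReal.le_div_iff_mul_le (Or.inl ((ENNReal.ofReal_pos.2 hlampos).ne'))
      (Or.inl ENNReal.ofReal_ne_top), mul_comm]
    exact hmarkov.trans hint
  calc volume {s ∈ Set.Ioo 0 T | ∃ x : EuclideanSpace ℝ (Fin 3),
          ENNReal.ofReal (M * R) < ∫⁻ y in Metric.ball x R, ‖u s y‖ₑ ^ 2}
      ≤ volume ({s | ENNReal.ofReal lam ≤ Z s} ∩ Ioo 0 T) := measure_mono hsub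
    _ ≤ μ {t | ENNReal.ofReal lam ≤ Z t} := Measure.le_restrict_apply _ _
    _ ≤ ENNReal.ofReal (VectorCalculus.kineticEnergy (u 0) / ν) / ENNReal.ofReal lam := hmeas_le
    _ = ENNReal.ofReal (VectorCalculus.kineticEnergy (u 0) / ν / lam) :=
        (ENNReal.ofReal_div_of_pos hlampos).symm
    _ = ENNReal.ofReal (C_A * R * VectorCalculus.kineticEnergy (u 0) / (ν * M)) := by
        congr 1
        rw [hlam]
        field_simp
end Summit.NavierStokesRegularity.NavierStokesRegularity.Theorems.EnstrophyQuarterLaw.EnstrophyScale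

end
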